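import Literature.AlgebraicTopology.SingularHomology.FiniteDeckTransfer
import Literature.AlgebraicGeometry.HodgeTheory.HypersurfaceComplementPoints
import Literature.AlgebraicGeometry.HodgeTheory.HypersurfaceLefschetzFromVanishing
import Literature.AlgebraicTopology.SingularHomology.ExcisionMayerVietorisProofs
import Literature.AlgebraicTopology.SingularHomology.KroneckerInjective
import Mathlib.Topology.Covering.Quotient
import Mathlib.Analysis.SpecialFunctions.Pow.Continuity
import Mathlib.RingTheory.RootsOfUnity.Complex
import HarnessLib

/-!
# The `μ_D`-covering `{F = 1} → ℂℙᴺ ∖ V(F)`: degree-two classes are `D`-torsion off a hypersurface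
# of degree `D`; tautness of `Y(ℂ) ⊆ ℙᴺ(ℂ)`

Family `hodge`, layer `Literature/AlgebraicGeometry/HodgeTheory`; sibling of
`HypersurfaceComplementPoints.lean` (the open set `U_F = {[z] | F(z) ≠ 0} ⊆ ℂℙᴺ` and its
identification with `(ℙᴺ ∖ V₊(F))(ℂ)`). For a form `F` of degree `D ≥ 1` the restriction of the Hopf
map `ℂᴺ⁺¹ ∖ {0} → ℂℙᴺ` to the affine hypersurface `Ũ_F = {v | F(v) = 1}` is a `D`-sheeted regular
covering `Ũ_F → U_F` with group `μ_D` acting by scalars (A. Dimca, *Singularities and Topology of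
Hypersurfaces* (1992), Ch. 4 (1.9)–(1.10); A. Hatcher, *Algebraic Topology* (2002), §1.3
Prop. 1.40 for coverings by free actions of finite groups). Since `H²(ℂᴺ⁺¹ ∖ {0}; ℤ) = 0`
(`≃ S²ᴺ⁺¹`), the transfer (Hatcher §3.G, `τ* π* = D`, the tree's `FiniteDeckTransfer`) shows that
**every `x ∈ H²(ℂℙᴺ; ℤ)` becomes `D`-torsion on `U_F`** — the topological shadow of
"`𝒪(D)|_{U_F}` is trivialised by `F`". Everything is PROVED (no named facts):

* `HypersurfaceComplement.CoverSpace hF hd` — `Ũ_F`, with its free continuous `μ_D`-action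
  (`rootsOfUnity D ℂ`) and the projection `proj : Ũ_F → U_F`; `surjective_proj`,
  `proj_eq_iff_mem_orbit` (the fibres are the orbits), `isOpenMap_proj` (local continuous sections
  `locSec`, a principal `D`-th root on an affine chart), hence `isQuotientMap_proj` and
  **`isCoveringMap_proj`** (Mathlib's `IsQuotientMap.isQuotientCoveringMap_of_properlyDiscontinuousSMul`),
  packaged as the finite regular covering `deckCover`;
* `isZero_singularHomology_neZero`, `singularCohomology_two_neZero_eq_zero` —
  `H₁ = H₂ = 0` and `H²(-; ℤ) = 0` for `ℂᴺ⁺¹ ∖ {0}`, `N ≥ 1` (the tree's punctured-space homology,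
  Hatcher Cor. 2.14, and universal coefficients, Thm. 3.2);
* **`smul_map_inclC_eq_zero`** — `D • x|_{U_F} = 0` for `x ∈ H²(ℂℙᴺ; ℤ)`, and its transport to the
  complex points `smul_map_subtypeVal_compl_range_eq_zero` (`D • y` dies on
  `↥(range Y(ℂ) → ℙᴺ(ℂ))ᶜ` for a closed immersion `Y → ℙᴺ_ℂ` onto `V₊(F)`);
* tautness: `exists_isOpen_map_subtypeVal_eq_zero_of_map_eq_zero` (a class vanishing on a taut
  subset vanishes on an open neighbourhood — Čech cohomology as a direct limit, Miller Def. 34.4,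
  Spanier Thm. 6.1.10), `nonempty_retractionNhds_range` (`Y(ℂ) ⊆ ℙᴺ(ℂ)` is taut for `Y` smooth
  projective), `exists_isOpen_map_eq_zero_of_map_eq_zero`.

Consumer: `Literature/Barriers/HodgeConjecture/IntegralCoefficientsKollarProofs` — the
non-vanishing of the fundamental class `ι(ℂ)_*[X_F(ℂ)]` of a smooth hypersurface (hypothesis (deg)
of the Kollár–Soulé–Voisin lattice step) by the cup product with supports.

## References

* [HatcherAT2002] A. Hatcher, Algebraic Topology, CUP 2002, §1.3 Props. 1.33–1.34, 1.39–1.40,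
  Cor. 2.14, §3.1 Thm. 3.2, §3.G p. 321 and Prop. 3G.1, App. A Thm. A.7, Cor. A.9.
* [Dimca1992] A. Dimca, Singularities and Topology of Hypersurfaces, Universitext, Springer 1992,
  Ch. 4 §1 (1.9)–(1.10) (the Milnor fibre `F⁻¹(1)` as a `μ_d`-covering of `ℂℙⁿ ∖ V(F)`).
* [Spanier1981] E. H. Spanier, Algebraic Topology, Springer 1981, Ch. 6 §1 Thm. 10.
* [Miller2020] H. Miller, Lectures on Algebraic Topology, 2020, Def. 34.4.
* [SerreGAGA1956] J.-P. Serre, GAGA, Ann. Inst. Fourier 6 (1956), §2 n°5 Prop. 2.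
-/

noncomputable section

universe u v

/-! ### The `μ_D`-covering `{F = 1} → U_F` of the complement of a degree-`D` hypersurface -/

namespace Literature.AlgebraicGeometry.HodgeTheory

open Literature.Topology.FourManifolds Literature.Topology.FourManifolds.ComplexProjectiveSpace

namespace HypersurfaceComplement

variable {N : ℕ} {F : MvPolynomial (Fin (N + 1)) ℂ} {D : ℕ}

/-- **The affine hypersurface `Ũ_F = {v ∈ ℂᴺ⁺¹ | F(v) = 1}`** (the "Milnor fibre" of the cone over
`V(F)`), total space of the `μ_D`-covering of `U_F = ℂℙᴺ ∖ V(F)` for a form `F` of degree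
`D ≥ 1` (Dimca, *Singularities and Topology of Hypersurfaces* (1992), Ch. 4 §1 (1.9)–(1.10): the
Hopf map restricts to a `D`-sheeted covering `F⁻¹(1) → ℂℙᴺ ∖ V(F)` with group `μ_D`). The proof
terms `hF`, `hd` are part of the type so that the `μ_D`-action is an instance.
[cite: Dimca1992, Ch. 4 §1 (1.9)–(1.10)] -/
def CoverSpace (_hF : F.IsHomogeneous D) (_hd : 0 < D) : Type :=
  {v : Fin (N + 1) → ℂ // MvPolynomial.eval v F = 1}

namespace CoverSpace

variable {hF : F.IsHomogeneous D} {hd : 0 < D}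

/-- The subspace topology from `ℂᴺ⁺¹`. [folklore] -/
instance : TopologicalSpace (CoverSpace hF hd) := instTopologicalSpaceSubtype

/-- The inclusion `Ũ_F ⊆ ℂᴺ⁺¹`. [folklore] -/
def val (v : CoverSpace hF hd) : Fin (N + 1) → ℂ := v.1

/-- Points of `Ũ_F` are determined by their coordinates. [folklore] -/
@[ext] theorem ext {v w : CoverSpace hF hd} (h : v.val = w.val) : v = w := Subtype.ext h

/-- `F = 1` on `Ũ_F`. [folklore] -/
theorem eval_val (v : CoverSpace hF hd) : MvPolynomial.eval v.val F = 1 := v.2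

/-- `F(0) = 0` for a form of positive degree, so `0 ∉ Ũ_F`. [folklore] -/
theorem eval_zero_eq_zero (hF : F.IsHomogeneous D) (hd : 0 < D) :
    MvPolynomial.eval (0 : Fin (N + 1) → ℂ) F = 0 := by
  have h := hF.eval_smul_eq (0 : ℂ) (0 : Fin (N + 1) → ℂ)
  rw [zero_smul, zero_pow hd.ne', zero_mul] at h
  exact h

/-- Points of `Ũ_F` are nonzero vectors. [folklore] -/
theorem val_ne_zero (v : CoverSpace hF hd) : v.val ≠ 0 := fun h => by
  have h1 := v.eval_val
  rw [h, eval_zero_eq_zero hF hd] at h1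
  exact zero_ne_one h1

/-- The inclusion `Ũ_F → ℂᴺ⁺¹` is continuous. [folklore] -/
theorem continuous_val : Continuous (val : CoverSpace hF hd → _) := continuous_subtype_val

/-- The inclusion `Ũ_F → ℂᴺ⁺¹` is an embedding. [folklore] -/
theorem isEmbedding_val : Topology.IsEmbedding (val : CoverSpace hF hd → _) :=
  Topology.IsEmbedding.subtypeVal

/-- `Ũ_F` is Hausdorff (a subspace of `ℂᴺ⁺¹`). [folklore] -/
instance : T2Space (CoverSpace hF hd) :=
  inferInstanceAs (T2Space {v : Fin (N + 1) → ℂ // MvPolynomial.eval v F = 1})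

/-- `Ũ_F` is locally compact (a closed subspace of `ℂᴺ⁺¹`). [folklore] -/
instance : LocallyCompactSpace (CoverSpace hF hd) :=
  (isClosed_eq (MvPolynomial.continuous_eval F) continuous_const :
    IsClosed {v : Fin (N + 1) → ℂ | MvPolynomial.eval v F = 1}).locallyCompactSpace

/-! #### The action of `μ_D` by scalars -/

/-- A `D`-th root of unity `ζ` has `(ζ : ℂ) ^ D = 1`. [folklore] -/
theorem coe_pow_eq_one (ζ : rootsOfUnity D ℂ) : (((ζ : ℂˣ) : ℂ)) ^ D = 1 :=
  (mem_rootsOfUnity' D (ζ : ℂˣ)).1 ζ.2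

/-- **`μ_D` acts on `Ũ_F` by scalar multiplication**: `F(ζ v) = ζᴰ F(v) = F(v)`. [folklore] -/
instance : MulAction (rootsOfUnity D ℂ) (CoverSpace hF hd) where
  smul ζ v := ⟨((ζ : ℂˣ) : ℂ) • v.val, by
    rw [hF.eval_smul_eq, coe_pow_eq_one, one_mul, v.eval_val]⟩
  one_smul v := by
    apply ext
    change ((((1 : rootsOfUnity D ℂ) : ℂˣ) : ℂ)) • v.val = v.val
    simp
  mul_smul ζ ξ v := by
    apply ext
    change ((((ζ * ξ : rootsOfUnity D ℂ) : ℂˣ) : ℂ)) • v.val =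
      (((ζ : ℂˣ) : ℂ)) • ((((ξ : ℂˣ) : ℂ)) • v.val)
    rw [smul_smul]
    simp

/-- `(ζ • v).val = ζ • v.val`. [folklore] -/
@[simp] theorem val_smul (ζ : rootsOfUnity D ℂ) (v : CoverSpace hF hd) :
    (ζ • v).val = (((ζ : ℂˣ) : ℂ)) • v.val := rfl

/-- The `μ_D`-action is continuous. [folklore] -/
instance : ContinuousConstSMul (rootsOfUnity D ℂ) (CoverSpace hF hd) where
  continuous_const_smul ζ := by
    rw [(isEmbedding_val (hF := hF) (hd := hd)).continuous_iff]
    exact (continuous_val (hF := hF) (hd := hd)).const_smul (((ζ : ℂˣ) : ℂ))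

/-- The action is free: `ζ v = v` with `v ≠ 0` forces `ζ = 1`. [folklore] -/
instance : IsCancelSMul (rootsOfUnity D ℂ) (CoverSpace hF hd) := by
  rw [isCancelSMul_iff_eq_one_of_smul_eq]
  intro ζ v h
  have h' : ((((ζ : ℂˣ) : ℂ)) - 1) • v.val = 0 := by
    rw [sub_smul, one_smul, sub_eq_zero]
    exact congrArg val h
  rcases smul_eq_zero.1 h' with h1 | h1
  · exact Subtype.ext (Units.ext (sub_eq_zero.1 h1))
  · exact absurd h1 (val_ne_zero v)

/-! #### The projection `Ũ_F → U_F` -/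

/-- The nonzero vector underlying a point of `Ũ_F`. [folklore] -/
def toNeZero (v : CoverSpace hF hd) : {v : Fin (N + 1) → ℂ // v ≠ 0} := ⟨v.val, val_ne_zero v⟩

/-- `Ũ_F → ℂᴺ⁺¹ ∖ {0}` is continuous. [folklore] -/
theorem continuous_toNeZero : Continuous (toNeZero (hF := hF) (hd := hd)) :=
  continuous_val.subtype_mk _

/-- `[v] ∈ U_F` for `v ∈ Ũ_F` (`F(v) = 1 ≠ 0`). [folklore] -/
theorem mk_toNeZero_mem (v : CoverSpace hF hd) : mk (toNeZero v) ∈ hypersurfaceComplement F hF := by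
  rw [mk_mem_hypersurfaceComplement_iff]
  change MvPolynomial.eval v.val F ≠ 0
  rw [v.eval_val]
  exact one_ne_zero

variable (hF hd) in
/-- **The covering projection `Ũ_F → U_F`, `v ↦ [v]`** (restriction of the Hopf map).
[cite: HatcherAT2002, §1.3] -/
def proj : C(CoverSpace hF hd, hypersurfaceComplement F hF) where
  toFun v := ⟨mk (toNeZero v), mk_toNeZero_mem v⟩
  continuous_toFun := (continuous_mk.comp continuous_toNeZero).subtype_mk _

/-- `proj v = [v]`. [folklore] -/
@[simp] theorem coe_proj (v : CoverSpace hF hd) : (proj hF hd v : ComplexProjectiveSpace N) = mk (toNeZero v) :=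
  rfl

/-- `μ_D` acts by deck transformations: `[ζ v] = [v]`. [folklore] -/
theorem proj_smul (ζ : rootsOfUnity D ℂ) (v : CoverSpace hF hd) : proj hF hd (ζ • v) = proj hF hd v := by
  apply Subtype.ext
  change mk (toNeZero (ζ • v)) = mk (toNeZero v)
  rw [mk_eq_mk_iff]
  exact ⟨((ζ : ℂˣ) : ℂ), rfl⟩

/-- **The fibres of `Ũ_F → U_F` are the `μ_D`-orbits**: `[v] = [w]` with `F(v) = F(w) = 1` forces
`w = ζ v` with `ζᴰ = 1`. [folklore] -/
theorem exists_smul_of_proj_eq {v w : CoverSpace hF hd} (h : proj hF hd w = proj hF hd v) :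
    ∃ ζ : rootsOfUnity D ℂ, w = ζ • v := by
  have h' : mk (toNeZero w) = mk (toNeZero v) := congrArg Subtype.val h
  rw [mk_eq_mk_iff] at h'
  obtain ⟨a, ha⟩ := h'
  change a • v.val = w.val at ha
  have haD : a ^ D = 1 := by
    have h1 := w.eval_val
    rw [← ha, hF.eval_smul_eq, v.eval_val, mul_one] at h1
    exact h1
  have ha0 : a ≠ 0 := by
    rintro rfl
    rw [zero_pow hd.ne'] at haD
    exact zero_ne_one haD
  refine ⟨⟨Units.mk0 a ha0, (mem_rootsOfUnity' D _).2 (by simpa using haD)⟩, ext ?_⟩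
  rw [val_smul]
  exact ha.symm

/-- The fibres of `proj` are exactly the `μ_D`-orbits. [folklore] -/
theorem proj_eq_iff_mem_orbit {v w : CoverSpace hF hd} :
    proj hF hd w = proj hF hd v ↔ w ∈ MulAction.orbit (rootsOfUnity D ℂ) v := by
  constructor
  · intro h
    obtain ⟨ζ, rfl⟩ := exists_smul_of_proj_eq h
    exact MulAction.mem_orbit v ζ
  · rintro ⟨ζ, rfl⟩
    exact proj_smul ζ v

/-- **`Ũ_F → U_F` is onto**: `[w]` with `F(w) ≠ 0` lifts to `t w` with `tᴰ = 1/F(w)`.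
[folklore] -/
theorem surjective_proj : Function.Surjective (proj hF hd) := by
  rintro ⟨x, hx⟩
  induction x using ComplexProjectiveSpace.ind with
  | h w =>
    rw [mk_mem_hypersurfaceComplement_iff] at hx
    -- `t` with `t ^ D = (F w)⁻¹`
    set t : ℂ := ((MvPolynomial.eval (w : Fin (N + 1) → ℂ) F)⁻¹) ^ ((D : ℂ)⁻¹) with ht
    have htD : t ^ D = (MvPolynomial.eval (w : Fin (N + 1) → ℂ) F)⁻¹ := Complex.cpow_nat_inv_pow _ hd.ne'
    have ht0 : t ≠ 0 := by
      intro h0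
      rw [h0, zero_pow hd.ne'] at htD
      exact inv_ne_zero hx htD.symm
    refine ⟨⟨t • (w : Fin (N + 1) → ℂ), ?_⟩, ?_⟩
    · rw [hF.eval_smul_eq, htD, inv_mul_cancel₀ hx]
    · apply Subtype.ext
      change mk _ = mk w
      rw [mk_eq_mk_iff]
      exact ⟨t, rfl⟩

/-! #### Local sections and openness of `Ũ_F → U_F` -/

/-- The normalised representative `[v] ↦ (v j / v i)ⱼ` on the chart `{v i ≠ 0}` (junk elsewhere).
[folklore] -/
def normRep (i : Fin (N + 1)) : ComplexProjectiveSpace N → (Fin (N + 1) → ℂ) :=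
  Projectivization.lift (fun v j ↦ (v : Fin (N + 1) → ℂ) j / (v : Fin (N + 1) → ℂ) i) (by
    rintro a b t h
    have ht : t ≠ 0 := by rintro rfl; exact a.2 (by simpa using h)
    funext j
    simp [h, mul_div_mul_left _ _ ht])

/-- `normRep i [v] = (v j / v i)ⱼ`. [folklore] -/
@[simp] theorem normRep_mk (i : Fin (N + 1)) (v : {v : Fin (N + 1) → ℂ // v ≠ 0}) :
    normRep i (mk v) = fun j ↦ (v : Fin (N + 1) → ℂ) j / (v : Fin (N + 1) → ℂ) i := rfl

/-- On the chart `{v i ≠ 0}` the normalised representative represents the point. [folklore] -/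
theorem mk_normRep (i : Fin (N + 1)) {x : ComplexProjectiveSpace N} (hx : CoordNeZero i x)
    (h0 : normRep i x ≠ 0) : mk ⟨normRep i x, h0⟩ = x := by
  induction x using ComplexProjectiveSpace.ind with
  | h v =>
    rw [mk_eq_mk_iff]
    rw [coordNeZero_mk] at hx
    refine ⟨((v : Fin (N + 1) → ℂ) i)⁻¹, ?_⟩
    change ((v : Fin (N + 1) → ℂ) i)⁻¹ • (v : Fin (N + 1) → ℂ) = normRep i (mk v)
    rw [normRep_mk]
    funext j
    simp [Pi.smul_apply, smul_eq_mul, div_eq_inv_mul]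

/-- The normalised representative is nonzero on the chart (its `i`-th coordinate is `1`). [folklore] -/
theorem normRep_ne_zero (i : Fin (N + 1)) {x : ComplexProjectiveSpace N} (hx : CoordNeZero i x) :
    normRep i x ≠ 0 := by
  induction x using ComplexProjectiveSpace.ind with
  | h v =>
    rw [coordNeZero_mk] at hx
    intro h
    have := congr_fun h i
    simp [div_self hx] at this

/-- The normalised representative is continuous on the chart. [folklore] -/
theorem continuousOn_normRep (i : Fin (N + 1)) :
    ContinuousOn (normRep (N := N) i) {x | CoordNeZero i x} := by
  refine continuousOn_of_comp_mk (isOpen_setOf_coordNeZero i) (continuousOn_pi.2 fun j ↦ ?_)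
  exact (((continuous_apply j).comp continuous_subtype_val).continuousOn).div
    (((continuous_apply i).comp continuous_subtype_val).continuousOn) fun v hv ↦ hv

/-- **A local section of `Ũ_F → U_F` through `v₀`** over the chart `{wᵢ ≠ 0}`, `(v₀)ᵢ ≠ 0`:
`[w] ↦ t(w) · ((v₀)ᵢ w / wᵢ)` with `t(w) = (1 / F((v₀)ᵢ w / wᵢ))^{1/D}` (principal branch), so that
`F = 1` on its values and `t([v₀]) = 1`. [folklore] -/
def locSec (e₀ : CoverSpace hF hd) (i : Fin (N + 1)) (x : ComplexProjectiveSpace N) : Fin (N + 1) → ℂ :=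
  ((MvPolynomial.eval (e₀.val i • normRep i x) F)⁻¹ ^ ((D : ℂ)⁻¹)) • (e₀.val i • normRep i x)

/-- The representative `(v₀)ᵢ • normRep i [v₀]` is `v₀`. [folklore] -/
theorem smul_normRep_proj (e₀ : CoverSpace hF hd) {i : Fin (N + 1)} (hi : e₀.val i ≠ 0) :
    e₀.val i • normRep i (proj hF hd e₀ : ComplexProjectiveSpace N) = e₀.val := by
  rw [coe_proj, normRep_mk]
  funext j
  change e₀.val i * (e₀.val j / e₀.val i) = e₀.val j
  rw [mul_div_cancel₀ _ hi]

/-- The local section passes through `v₀`. [folklore] -/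
theorem locSec_proj (e₀ : CoverSpace hF hd) {i : Fin (N + 1)} (hi : e₀.val i ≠ 0) :
    locSec e₀ i (proj hF hd e₀) = e₀.val := by
  unfold locSec
  rw [smul_normRep_proj e₀ hi, e₀.eval_val, inv_one, Complex.one_cpow, one_smul]

/-- The local section is continuous at `[v₀]`. [folklore] -/
theorem continuousAt_locSec (e₀ : CoverSpace hF hd) {i : Fin (N + 1)} (hi : e₀.val i ≠ 0) :
    ContinuousAt (locSec e₀ i) (proj hF hd e₀ : ComplexProjectiveSpace N) := by
  have hi0 : CoordNeZero i (proj hF hd e₀ : ComplexProjectiveSpace N) := hi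
  have hs : ContinuousAt (fun x => e₀.val i • normRep i x) (proj hF hd e₀ : ComplexProjectiveSpace N) :=
    ((continuousOn_normRep i).continuousAt ((isOpen_setOf_coordNeZero i).mem_nhds hi0)).const_smul
      (e₀.val i)
  have hg : ContinuousAt (fun x => MvPolynomial.eval (e₀.val i • normRep i x) F)
      (proj hF hd e₀ : ComplexProjectiveSpace N) :=
    (MvPolynomial.continuous_eval F).continuousAt.comp hs
  have hg0 : MvPolynomial.eval (e₀.val i • normRep i (proj hF hd e₀ : ComplexProjectiveSpace N)) F = 1 := by
    rw [smul_normRep_proj e₀ hi, e₀.eval_val]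
  have hinv : ContinuousAt (fun x => (MvPolynomial.eval (e₀.val i • normRep i x) F)⁻¹)
      (proj hF hd e₀ : ComplexProjectiveSpace N) := hg.inv₀ (by rw [hg0]; exact one_ne_zero)
  have hpow : ContinuousAt (fun z : ℂ => z ^ ((D : ℂ)⁻¹))
      ((MvPolynomial.eval (e₀.val i • normRep i (proj hF hd e₀ : ComplexProjectiveSpace N)) F)⁻¹) := by
    apply continuousAt_cpow_const
    rw [hg0, inv_one]
    exact Complex.one_mem_slitPlane
  exact (hpow.comp_of_eq hinv rfl).smul hs

/-- On the chart, inside `U_F`, the local section takes values in `Ũ_F` and is a section: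
`F(σ x) = 1` and `[σ x] = x`. [folklore] -/
theorem locSec_spec (e₀ : CoverSpace hF hd) {i : Fin (N + 1)} (hi : e₀.val i ≠ 0)
    {x : ComplexProjectiveSpace N} (hxi : CoordNeZero i x) (hxU : x ∈ hypersurfaceComplement F hF) :
    ∃ hx1 : MvPolynomial.eval (locSec e₀ i x) F = 1,
      (proj hF hd ⟨locSec e₀ i x, hx1⟩ : ComplexProjectiveSpace N) = x := by
  have hn0 : normRep i x ≠ 0 := normRep_ne_zero i hxi
  have hmk : mk ⟨normRep i x, hn0⟩ = x := mk_normRep i hxi hn0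
  have hgx : MvPolynomial.eval (e₀.val i • normRep i x) F ≠ 0 := by
    rw [hF.eval_smul_eq]
    refine mul_ne_zero (pow_ne_zero _ hi) ?_
    rw [← hmk, mk_mem_hypersurfaceComplement_iff] at hxU
    exact hxU
  have htD : ((MvPolynomial.eval (e₀.val i • normRep i x) F)⁻¹ ^ ((D : ℂ)⁻¹)) ^ D =
      (MvPolynomial.eval (e₀.val i • normRep i x) F)⁻¹ := Complex.cpow_nat_inv_pow _ hd.ne'
  have hx1 : MvPolynomial.eval (locSec e₀ i x) F = 1 := by
    unfold locSec
    rw [hF.eval_smul_eq, htD]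
    exact inv_mul_cancel₀ hgx
  refine ⟨hx1, ?_⟩
  rw [coe_proj]
  conv_rhs => rw [← hmk]
  rw [mk_eq_mk_iff]
  refine ⟨(MvPolynomial.eval (e₀.val i • normRep i x) F)⁻¹ ^ ((D : ℂ)⁻¹) * e₀.val i, ?_⟩
  change ((MvPolynomial.eval (e₀.val i • normRep i x) F)⁻¹ ^ ((D : ℂ)⁻¹) * e₀.val i) • normRep i x =
    locSec e₀ i x
  unfold locSec
  rw [smul_smul]

/-- **`Ũ_F → U_F` is an open map** (it has local continuous sections through every point,
`locSec`). [folklore] -/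
theorem isOpenMap_proj : IsOpenMap (proj hF hd) := by
  intro O hO
  rw [isOpen_iff_mem_nhds]
  rintro b ⟨e₀, he₀O, rfl⟩
  obtain ⟨i, hi⟩ := exists_coordNeZero (proj hF hd e₀ : ComplexProjectiveSpace N)
  have hi' : e₀.val i ≠ 0 := hi
  -- `O = val ⁻¹' O'` for an open `O'` of `ℂᴺ⁺¹`
  obtain ⟨O', hO', hOO'⟩ := (isEmbedding_val (hF := hF) (hd := hd)).isOpen_iff.1 hO
  -- the section pulls `O'` back to a neighbourhood of `[v₀]`
  have hmem : locSec e₀ i ⁻¹' O' ∈ nhds (proj hF hd e₀ : ComplexProjectiveSpace N) := by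
    apply (continuousAt_locSec e₀ hi').preimage_mem_nhds
    rw [locSec_proj e₀ hi']
    apply hO'.mem_nhds
    have : e₀ ∈ val ⁻¹' O' := by rw [hOO']; exact he₀O
    exact this
  have hchart : {x : ComplexProjectiveSpace N | CoordNeZero i x} ∈
      nhds (proj hF hd e₀ : ComplexProjectiveSpace N) := (isOpen_setOf_coordNeZero i).mem_nhds hi
  have hval : Filter.Tendsto (Subtype.val : hypersurfaceComplement F hF → ComplexProjectiveSpace N)
      (nhds (proj hF hd e₀)) (nhds (proj hF hd e₀ : ComplexProjectiveSpace N)) :=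
    continuous_subtype_val.continuousAt
  filter_upwards [hval hmem, hval hchart] with x hx hxi
  obtain ⟨hx1, hpx⟩ := locSec_spec e₀ hi' hxi x.2
  refine ⟨⟨locSec e₀ i x, hx1⟩, ?_, Subtype.ext hpx⟩
  rw [← hOO']
  exact hx

/-- `Ũ_F → U_F` is a topological quotient map (open, continuous, onto). [folklore] -/
theorem isQuotientMap_proj : Topology.IsQuotientMap (proj hF hd) :=
  isOpenMap_proj.isQuotientMap (proj hF hd).continuous surjective_proj

/-- **`Ũ_F → U_F` is a covering map** with group `μ_D`: the quotient map of the free action of the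
finite group `μ_D` on the locally compact Hausdorff space `Ũ_F` (Mathlib's
`IsQuotientMap.isQuotientCoveringMap_of_properlyDiscontinuousSMul`). [cite: HatcherAT2002, §1.3 Prop. 1.40]
[cite: Dimca1992, Ch. 4 §1 (1.9)–(1.10)] -/
theorem isCoveringMap_proj : IsCoveringMap (proj hF hd) := by
  haveI : Fact (0 < D) := ⟨hd⟩
  haveI : NeZero D := ⟨hd.ne'⟩
  exact ((isQuotientMap_proj (hF := hF) (hd := hd)).isQuotientCoveringMap_of_properlyDiscontinuousSMul
    (G := rootsOfUnity D ℂ) proj_eq_iff_mem_orbit).isCoveringMap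

attribute [local instance] Fintype.ofFinite in
variable (hF hd) in
/-- **The `μ_D`-covering `Ũ_F → U_F` as a finite regular covering** (for the transfer). [folklore] -/
def deckCover [NeZero D] :
    Literature.AlgebraicTopology.SingularHomology.FiniteDeckCover (rootsOfUnity D ℂ)
      (CoverSpace hF hd) (hypersurfaceComplement F hF) where
  proj := proj hF hd
  isCoveringMap_proj := isCoveringMap_proj
  surjective_proj := surjective_proj
  continuous_smul ζ := continuous_const_smul ζ
  proj_smul := proj_smul
  exists_smul_of_proj_eq := exists_smul_of_proj_eq

end CoverSpace

end HypersurfaceComplement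

end Literature.AlgebraicGeometry.HodgeTheory

/-! ### `H²(ℂᴺ⁺¹ ∖ {0}; ℤ) = 0` and the `D`-torsion of degree-two classes off a degree-`D` hypersurface -/

namespace Literature.AlgebraicGeometry.HodgeTheory

open Literature.Topology.FourManifolds Literature.Topology.FourManifolds.ComplexProjectiveSpace
open Literature.AlgebraicTopology.SingularHomology CategoryTheory

namespace HypersurfaceComplement

/-- **`ℂᴺ⁺¹ ∖ {0} ≃ₜ ℝ²ᴺ⁺² ∖ {0}`** (any real-linear identification `ℂᴺ⁺¹ ≅ ℝ²ᴺ⁺²` fixes `0`).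
[folklore] -/
def neZeroHomeomorphPunctured (N : ℕ) :
    {v : Fin (N + 1) → ℂ // v ≠ 0} ≃ₜ ↥(punctured (2 * (N + 1))) :=
  let L : (Fin (N + 1) → ℂ) ≃L[ℝ] (Fin (2 * (N + 1)) → ℝ) :=
    ContinuousLinearEquiv.ofFinrankEq (by
      rw [Module.finrank_pi_fintype, Module.finrank_pi ℝ]
      simp [Complex.finrank_real_complex, Finset.sum_const, mul_comm])
  L.toHomeomorph.subtype fun v => by
    change v ≠ 0 ↔ L v ≠ 0
    rw [not_iff_not]
    exact (map_eq_zero_iff L L.injective).symm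

/-- **`H_j(ℂᴺ⁺¹ ∖ {0}; ℤ) = 0` for `j = 1, 2` and `N ≥ 1`** (`ℂᴺ⁺¹ ∖ {0} ≃ S²ᴺ⁺¹` with
`2N + 1 ≥ 3`; Hatcher Cor. 2.14, the tree's `isZero_homology_punctured_of_succ_ne`).
[cite: HatcherAT2002, Cor. 2.14] -/
theorem isZero_singularHomology_neZero {N : ℕ} (hN : 1 ≤ N) {j : ℕ} (hj1 : 1 ≤ j) (hj2 : j ≤ 2) :
    Limits.IsZero (singularHomology ℤ ℤ {v : Fin (N + 1) → ℂ // v ≠ 0} j) := by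
  have h := isZero_homology_punctured_of_succ_ne ℤ ℤ j (2 * (N + 1)) hj1 (by omega)
  exact (h.of_iso (csingularHomology.compIso ℤ ℤ (↥(punctured (2 * (N + 1)))) j).symm).of_iso
    ((HomologicalComplex.homologyFunctor _ _ j).mapIso
      (singularChainComplex.mapHomeomorph ℤ ℤ (neZeroHomeomorphPunctured N)))

/-- **`H²(ℂᴺ⁺¹ ∖ {0}; ℤ) = 0` for `N ≥ 1`**: the Kronecker map `H² → Hom(H₂, ℤ)` is injective
since `H₁ = 0` (universal coefficients, Hatcher Thm. 3.2; the tree's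
`kroneckerPairing_injective_of_isZero`), and `H₂ = 0`. [cite: HatcherAT2002, §3.1 Thm. 3.2 and Cor. 2.14] -/
theorem singularCohomology_two_neZero_eq_zero {N : ℕ} (hN : 1 ≤ N)
    (y : singularCohomology ℤ ℤ {v : Fin (N + 1) → ℂ // v ≠ 0} 2) : y = 0 := by
  have hinj := kroneckerPairing_injective_of_isZero ℤ {v : Fin (N + 1) → ℂ // v ≠ 0} 1
    (isZero_singularHomology_neZero hN le_rfl (by norm_num))
  haveI : Subsingleton (singularHomology ℤ ℤ {v : Fin (N + 1) → ℂ // v ≠ 0} 2 →ₗ[ℤ] ℤ) := by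
    haveI := ModuleCat.subsingleton_of_isZero (isZero_singularHomology_neZero hN (by norm_num) le_rfl)
    infer_instance
  exact hinj (Subsingleton.elim _ _)

variable {N : ℕ} {F : MvPolynomial (Fin (N + 1)) ℂ} {D : ℕ}

/-- The quotient map `ℂᴺ⁺¹ ∖ {0} → ℂℙᴺ` as a bundled continuous map. [folklore] -/
def mkC (N : ℕ) : C({v : Fin (N + 1) → ℂ // v ≠ 0}, ComplexProjectiveSpace N) := ⟨mk, continuous_mk⟩

/-- The inclusion `U_F ↪ ℂℙᴺ` as a bundled continuous map. [folklore] -/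
def inclC (F : MvPolynomial (Fin (N + 1)) ℂ) {D : ℕ} (hF : F.IsHomogeneous D) :
    C(↥(hypersurfaceComplement F hF), ComplexProjectiveSpace N) :=
  ⟨Subtype.val, continuous_subtype_val⟩

/-- `U_F ↪ ℂℙᴺ` after `Ũ_F → U_F` is `ℂᴺ⁺¹ ∖ {0} → ℂℙᴺ` after `Ũ_F ⊆ ℂᴺ⁺¹ ∖ {0}`. [folklore] -/
theorem inclC_comp_proj {hF : F.IsHomogeneous D} {hd : 0 < D} :
    (inclC F hF).comp (CoverSpace.proj hF hd) =
      (mkC N).comp ⟨CoverSpace.toNeZero, CoverSpace.continuous_toNeZero⟩ :=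
  ContinuousMap.ext fun _ => rfl

attribute [local instance] Fintype.ofFinite in
/-- **Degree-two classes of `ℂℙᴺ` are `D`-torsion off a hypersurface of degree `D`.** For a form `F`
of degree `D ≥ 1` in `N + 1 ≥ 2` variables and every `x ∈ H²(ℂℙᴺ; ℤ)`, `D • x|_{U_F} = 0` in
`H²(U_F; ℤ)`, `U_F = ℂℙᴺ ∖ V(F)`: the pull-back of `x|_{U_F}` to the `D`-sheeted covering
`Ũ_F = {F = 1} → U_F` factors through `H²(ℂᴺ⁺¹ ∖ {0}; ℤ) = 0`, and classes killed by the pull-back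
to a `D`-sheeted covering are `D`-torsion (transfer, Hatcher §3.G, `τ* π* = D`). (For
`x = c₁(𝒪(1))`: `D x|_{U_F} = c₁(𝒪(D)|_{U_F}) = 0`, the section `F` trivialising `𝒪(D)` on `U_F`.)
[cite: HatcherAT2002, §3.G p. 321 and Prop. 3G.1] -/
theorem smul_map_inclC_eq_zero (hF : F.IsHomogeneous D) (hd : 0 < D) (hN : 1 ≤ N)
    (x : singularCohomology ℤ ℤ (ComplexProjectiveSpace N) 2) :
    D • singularCohomology.map ℤ ℤ (inclC F hF) 2 x = 0 := by
  haveI : NeZero D := ⟨hd.ne'⟩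
  have hcard : Fintype.card (rootsOfUnity D ℂ) = D := by
    rw [← Nat.card_eq_fintype_card]; exact Complex.card_rootsOfUnity D
  have key := (CoverSpace.deckCover hF hd).card_smul_eq_zero_of_map_eq_zero (R := ℤ) 2
    (x := singularCohomology.map ℤ ℤ (inclC F hF) 2 x) (by
      change singularCohomology.map ℤ ℤ (CoverSpace.proj hF hd) 2
        (singularCohomology.map ℤ ℤ (inclC F hF) 2 x) = 0
      rw [← ModuleCat.comp_apply, ← singularCohomology.map_comp, inclC_comp_proj,
        singularCohomology.map_comp, ModuleCat.comp_apply,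
        singularCohomology_two_neZero_eq_zero hN (singularCohomology.map ℤ ℤ (mkC N) 2 x), map_zero])
  rwa [hcard] at key

end HypersurfaceComplement

/-! ### On the complex points: `D • c|_{(ℙᴺ ∖ Y)(ℂ)} = 0` for a hypersurface `Y = V₊(F)` of degree `D` -/

section SchemeSide

open Literature.AlgebraicGeometry.Motives _root_.AlgebraicGeometry

attribute [local instance] MvPolynomial.gradedAlgebra

/-- **Degree-two classes of `ℙᴺ(ℂ)` are `D`-torsion off a degree-`D` hypersurface**, on the complex
points: for a closed immersion `ι : Y → ℙᴺ_ℂ` onto `V₊(F)`, `F` a form of degree `D ≥ 1`, `N ≥ 1`,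
and every `y ∈ H²(ℙᴺ(ℂ); ℤ)`, the restriction of `D • y` to the open complement
`↥(range Y(ℂ) → ℙᴺ(ℂ))ᶜ` vanishes (`smul_map_inclC_eq_zero` transported along Serre's comparison
`ℙᴺ(ℂ) ≃ₜ ℂℙᴺ`, `complRangeHomeomorph`). [cite: HatcherAT2002, §3.G Prop. 3G.1]
[cite: SerreGAGA1956, §2 n°5 Prop. 2] -/
theorem smul_map_subtypeVal_compl_range_eq_zero {N D : ℕ} {Y : SchemeOver ℂ}
    (ι : Y ⟶ projectiveSpace N ℂ) [IsClosedImmersion ι.left] {F : MvPolynomial (Fin (N + 1)) ℂ}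
    (hF : F.IsHomogeneous D) (hd : 0 < D) (hN : 1 ≤ N)
    (hrange : Set.range ι.left.base =
      ProjectiveSpectrum.zeroLocus (MvPolynomial.homogeneousSubmodule (Fin (N + 1)) ℂ) {F})
    (y : singularCohomology ℤ ℤ (ComplexPoints (projectiveSpace N ℂ)) 2) :
    D • singularCohomology.map ℤ ℤ
      (⟨Subtype.val, continuous_subtype_val⟩ :
        C(↥(Set.range (AlgPoints.map (L := ℂ) ι))ᶜ, ComplexPoints (projectiveSpace N ℂ))) 2 y = 0 := by
  -- `y = e^* x` for Serre's comparison `e : ℙᴺ(ℂ) ≃ₜ ℂℙᴺ`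
  let e := complexPointsProjectiveSpaceHomeomorph N
  let x := singularCohomology.map ℤ ℤ (e.symm : C(ComplexProjectiveSpace N, ComplexPoints (projectiveSpace N ℂ))) 2 y
  have hy : y = singularCohomology.map ℤ ℤ (e : C(ComplexPoints (projectiveSpace N ℂ), ComplexProjectiveSpace N)) 2 x := by
    change y = singularCohomology.map ℤ ℤ (e : C(ComplexPoints (projectiveSpace N ℂ), ComplexProjectiveSpace N)) 2
      (singularCohomology.map ℤ ℤ (e.symm : C(ComplexProjectiveSpace N, ComplexPoints (projectiveSpace N ℂ))) 2 y)
    rw [← ModuleCat.comp_apply, ← singularCohomology.map_comp]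
    have : (e.symm : C(ComplexProjectiveSpace N, ComplexPoints (projectiveSpace N ℂ))).comp (e : C(ComplexPoints (projectiveSpace N ℂ), ComplexProjectiveSpace N)) = ContinuousMap.id _ :=
      ContinuousMap.ext fun p => e.symm_apply_apply p
    rw [this, singularCohomology.map_id]; rfl
  -- the square `(range)ᶜ → ℙᴺ(ℂ) → ℂℙᴺ` = `(range)ᶜ ≃ U_F → ℂℙᴺ`
  have hsq : (e : C(ComplexPoints (projectiveSpace N ℂ), ComplexProjectiveSpace N)).comp
      (⟨Subtype.val, continuous_subtype_val⟩ :
        C(↥(Set.range (AlgPoints.map (L := ℂ) ι))ᶜ, ComplexPoints (projectiveSpace N ℂ))) =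
      (HypersurfaceComplement.inclC F hF).comp
        (complRangeHomeomorph ι hF hd hrange : C(_, ↥(ComplexProjectiveSpace.hypersurfaceComplement F hF))) :=
    ContinuousMap.ext fun _ => rfl
  rw [hy, ← ModuleCat.comp_apply, ← singularCohomology.map_comp, hsq, singularCohomology.map_comp,
    ModuleCat.comp_apply, ← map_nsmul, HypersurfaceComplement.smul_map_inclC_eq_zero hF hd hN x, map_zero]

end SchemeSide


/-! ### Tautness of `Y(ℂ) ⊆ ℙᴺ(ℂ)`: a class vanishing on `Y(ℂ)` vanishes on a neighbourhood -/

section Tautness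

open Literature.AlgebraicGeometry.Motives _root_.AlgebraicGeometry Literature.AlgebraicTopology.Homotopy
  _root_.Topology

/-- **A class vanishing on a taut subset vanishes on some open neighbourhood of it.** For `K ⊆ X`
with a tautness datum (`Cech.RetractionNhds K`: `Ȟᵖ(K) ≅ Hᵖ(↥K)`, Spanier Thm. 6.1.10) and
`a ∈ Hᵖ(X; R)` with `a|_K = 0`, there is an open `V ⊇ K` with `a|_V = 0`: the restriction to `K`
factors through `Ȟᵖ(K) = lim_→ Hᵖ(V)` (Miller Def. 34.4), in which a class is zero iff it is zero
on some neighbourhood. [cite: Spanier1981, Ch. 6 §1 Thm. 10] [cite: Miller2020, Def. 34.4] -/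
theorem exists_isOpen_map_subtypeVal_eq_zero_of_map_eq_zero {R : Type v} [CommRing R] {X : Type u}
    [TopologicalSpace X] {K : Set X} (T : Cech.RetractionNhds K) {p : ℕ}
    {a : singularCohomology R R X p}
    (ha : singularCohomology.map R R (⟨Subtype.val, continuous_subtype_val⟩ : C(↥K, X)) p a = 0) :
    ∃ V : Set X, IsOpen V ∧ K ⊆ V ∧
      singularCohomology.map R R (⟨Subtype.val, continuous_subtype_val⟩ : C(↥V, X)) p a = 0 := by
  rw [singularCohomology.map_subtypeVal_eq_toSingularCohomology K p a] at ha
  have h1 : Cech.restrict R (SimplexSpan.coefR R) (Set.subset_univ K) p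
      (Cech.of R (SimplexSpan.coefR R) (OpenNhd.univ (Set.univ : Set X))
        (subsetCochains.thetaInv p a)) = 0 :=
    (T.bijective_toSingularCohomology p).1 (ha.trans (map_zero _).symm)
  rw [Cech.restrict_of, Cech.of_eq_zero_iff] at h1
  obtain ⟨V, hUV, hV⟩ := h1
  exact ⟨V.carrier, V.isOpen, V.subset, (subsetCochains.resH_thetaInv_eq_zero_iff V.carrier p a).1 hV⟩

/-- **`Y(ℂ) ⊆ ℙᴺ(ℂ)` is taut**: for `Y` smooth projective and a closed immersion `ι : Y → ℙᴺ_ℂ`, the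
compact image `K = ι(Y(ℂ))` has a tautness datum in `ℙᴺ(ℂ)` — `ℙᴺ(ℂ) ↪ ℝᵐ` is a Euclidean
neighbourhood retract (Hatcher Thm. A.7 / Cor. A.9) and `K ≅ Y(ℂ)` is a compact manifold, hence
locally contractible (Spanier Thm. 6.1.10; the tree's
`Cech.RetractionNhds.nonempty_of_locallyContractibleSpace`). [cite: Spanier1981, Ch. 6 §1 Thm. 10]
[cite: HatcherAT2002, Appendix Thm. A.7 and Cor. A.9] -/
theorem nonempty_retractionNhds_range {m N : ℕ} {Y : SchemeOver ℂ} (hY : IsSmoothProjective m Y)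
    (ι : Y ⟶ projectiveSpace N ℂ) [IsClosedImmersion ι.left] :
    Nonempty (Cech.RetractionNhds (Set.range (AlgPoints.map (L := ℂ) ι) :
      Set (ComplexPoints (projectiveSpace N ℂ)))) := by
  classical
  have hP : IsSmoothProjective N (projectiveSpace N ℂ) := isSmoothProjective_projectiveSpace_holds ℂ N
  letI := hP.chartedSpace
  haveI := ComplexPoints.compactSpace_of_isSmoothProjective hP
  haveI := ComplexPoints.t2Space_of_isSmoothProjective hP
  haveI := ComplexPoints.compactSpace_of_isSmoothProjective hY
  have hemb : IsEmbedding (AlgPoints.map (L := ℂ) ι) := AlgPoints.isEmbedding_map_of_isClosedImmersion ι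
  have hKc : IsCompact (Set.range (AlgPoints.map (L := ℂ) ι)) := isCompact_range hemb.continuous
  obtain ⟨m', f, hf⟩ := Literature.Geometry.Manifold.exists_isClosedEmbedding_pi_of_compactSpace
    (M := ComplexPoints (projectiveSpace N ℂ)) (EuclideanSpace ℝ (Fin (2 * N)))
  have hNR : IsNeighbourhoodRetract (Set.range f) :=
    isNeighbourhoodRetract_range_of_compactSpace
      isNeighbourhoodRetract_of_locallyContractibleSpace_holds (EuclideanSpace ℝ (Fin (2 * N)))
      hf.isEmbedding
  have hKl : LocallyContractibleSpace (Set.range (AlgPoints.map (L := ℂ) ι)) := by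
    letI := hY.chartedSpace
    exact locallyContractibleSpace_of_homeomorph hemb.toHomeomorph
      (locallyContractibleSpace_of_chartedSpace (EuclideanSpace ℝ (Fin (2 * m)))
        (M := ComplexPoints Y))
  exact Cech.RetractionNhds.nonempty_of_locallyContractibleSpace hf.isEmbedding hNR hKc hKl

/-- **A class of `ℙᴺ(ℂ)` vanishing on `Y(ℂ)` vanishes on an open neighbourhood of `ι(Y(ℂ))`**
(`Y` smooth projective, `ι` a closed immersion; tautness). [cite: Spanier1981, Ch. 6 §1 Thm. 10] -/
theorem exists_isOpen_map_eq_zero_of_map_eq_zero {R : Type} [CommRing R] {m N : ℕ}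
    {Y : SchemeOver ℂ} (hY : IsSmoothProjective m Y) (ι : Y ⟶ projectiveSpace N ℂ)
    [IsClosedImmersion ι.left] {p : ℕ} {a : singularCohomology R R (ComplexPoints (projectiveSpace N ℂ)) p}
    (ha : singularCohomology.map R R (AlgPoints.mapContinuous (L := ℂ) ι) p a = 0) :
    ∃ V : Set (ComplexPoints (projectiveSpace N ℂ)), IsOpen V ∧
      Set.range (AlgPoints.map (L := ℂ) ι) ⊆ V ∧
      singularCohomology.map R R (⟨Subtype.val, continuous_subtype_val⟩ : C(↥V, _)) p a = 0 := by
  obtain ⟨T⟩ := nonempty_retractionNhds_range hY ι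
  have hemb : IsEmbedding (AlgPoints.map (L := ℂ) ι) := AlgPoints.isEmbedding_map_of_isClosedImmersion ι
  refine exists_isOpen_map_subtypeVal_eq_zero_of_map_eq_zero T ?_
  -- `ι(ℂ) = (↥K ↪ ℙᴺ(ℂ)) ∘ (Y(ℂ) ≃ K)` and the second factor is bijective on `Hᵖ`
  have hfac : AlgPoints.mapContinuous (L := ℂ) ι =
      (⟨Subtype.val, continuous_subtype_val⟩ :
        C(↥(Set.range (AlgPoints.map (L := ℂ) ι)), ComplexPoints (projectiveSpace N ℂ))).comp
        (hemb.toHomeomorph : C(ComplexPoints Y, ↥(Set.range (AlgPoints.map (L := ℂ) ι)))) := rfl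
  rw [hfac, singularCohomology.map_comp, ModuleCat.comp_apply] at ha
  have hinj : Function.Injective (singularCohomology.map R R
      (hemb.toHomeomorph : C(ComplexPoints Y, ↥(Set.range (AlgPoints.map (L := ℂ) ι)))) p) :=
    ((forget (ModuleCat R)).mapIso (singularCohomology.mapIso R R hemb.toHomeomorph p)).toEquiv.bijective.1
  exact (map_eq_zero_iff (singularCohomology.map R R
    (hemb.toHomeomorph : C(ComplexPoints Y, ↥(Set.range (AlgPoints.map (L := ℂ) ι)))) p).hom hinj).1 ha

end Tautness

end Literature.AlgebraicGeometry.HodgeTheory
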